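import Literature.Probability.RandomPlanarGeometry.SAWKSiteLargestClass
import Literature.Probability.RandomPlanarGeometry.SAWKSitePatternCube
import Literature.Probability.RandomPlanarGeometry.SAWPatternTheoremEmbedded
import HarnessLib

/-!
# Madras–Slade Theorem 9.4.2, unconditionally: Kesten's bound for the pattern of Figure 9.11 discharged

Topic `Literature/Probability/RandomPlanarGeometry` (over `SAWKSiteLargestClass.lean`: `Thm942.clec`, the named fact
`KestenBoundPat`, `MadrasSlade1993_thm942_of_kesten`; `SAWKSitePatternCube.lean`: the corner-to-corner walk `phi k`
carrying `P_k`; `SAWPatternTheoremEmbedded.lean`: Kesten's Pattern Theorem 7.2.3 (b) for patterns occurring on a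
corner-to-corner walk in a cube, `thm723b_of_cornerWalk`). Source: N. Madras, G. Slade, *The Self-Avoiding Walk*
(Birkhäuser 1993), Theorem 9.4.2 (p. 319), §9.7.2 (pp. 349–350), Theorem 7.2.3 (p. 233), Proposition 7.1.3 (p. 232).

THIS FILE (namespace `Literature.Probability.RandomPlanarGeometry.SAW.Zd.Thm942`):
* `patList k` — `P_k` as a site list; `occPat_patList_iff` / `patCount_patList` — the §7 chain's occurrence count of
  `patList k` is the cardinality of `occSet k`;
* ★ `kestenBoundPat_holds : KestenBoundPat k` — (9.7.5) discharged: `P_k` occurs on the corner walk `φ_k`, so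
  Kesten's theorem applies;
* ★★ `MadrasSlade1993_thm942 : 1 ≤ k → ∃ ε > 0, ∃ N₀, ∀ N ≥ N₀, CLEC_{k,N} ≤ ((1-ε) μ)^N` — **Theorem 9.4.2 for
  `d = 2`, unconditional** (standard axioms): for every `k`, the largest ergodicity class of MAX(`k`) — hence of any
  `k`-site length-conserving algorithm — on `S_N(ℤ²)` is exponentially smaller than `c_N`, i.e.
  `limsup (CLEC_{k,N})^{1/N} ≤ (1-ε)μ < μ`.

## References
* N. Madras, G. Slade, *The Self-Avoiding Walk*, Birkhäuser (1993): Theorem 9.4.2 (p. 319); §9.7.2 (pp. 349–350);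
  Theorem 7.2.3 (p. 233); H. Kesten, J. Math. Phys. 4 (1963) 960–969; N. Madras, A. D. Sokal, J. Stat. Phys. 47 (1987).
-/

noncomputable section

open Finset Filter Literature.Probability.LatticeModels Literature.Probability.Percolation SimpleGraph
open scoped BigOperators Topology

namespace Literature.Probability.RandomPlanarGeometry.SAW.Zd

namespace Thm942

open LocalMove Classical

/-- `P_k` as a site list (`10k+40` sites). [cite: MadrasSlade1993, §9.7.2 (p. 349)] -/
def patList (k : ℕ) : List (Site 2) := List.ofFn fun i : Fin (10 * k + 40) => pat k i

/-- Length of `patList`. [folklore] -/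
private theorem length_patList (k : ℕ) : (patList k).length = 10 * k + 40 := by
  simp only [patList, List.length_ofFn]

/-- Entries of `patList`. [folklore] -/
private theorem getD_patList (k : ℕ) {t : ℕ} (ht : t ≤ 10 * k + 39) : (patList k).getD t 0 = pat k t := by
  have h1 : t < (patList k).length := by rw [length_patList]; omega
  rw [List.getD_eq_getElem _ _ h1]
  simp only [patList, List.getElem_ofFn]

/-- The §7 chain's occurrence predicate for `patList k` is `OccAt k`. [cite: MadrasSlade1993, Definition 7.1.1] -/
theorem occPat_patList_iff {k N m : ℕ} {ω : ℕ → Site 2} :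
    OccPat (d := 0) (patList k) N ω m ↔ m + (10 * k + 39) ≤ N ∧ OccAt k m ω := by
  unfold OccPat OccAt
  rw [length_patList, show 10 * k + 40 - 1 = 10 * k + 39 by omega]
  refine and_congr Iff.rfl (forall_congr' fun t => forall_congr' fun ht => ?_)
  rw [getD_patList k ht, getD_patList k (by omega), pat_zero, sub_zero]

/-- Hence `patCount (patList k) N ω = |occSet k N ω|`. [cite: MadrasSlade1993, Definition 7.1.2] -/
theorem patCount_patList (k N : ℕ) (ω : ℕ → Site 2) : patCount (d := 0) (patList k) N ω = (occSet k N ω).card := by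
  unfold patCount patSites occSet
  congr 1
  refine Finset.filter_congr fun m _ => ?_
  exact occPat_patList_iff

/-- ★ **(9.7.5) discharged**: Kesten's bound holds for `P_k` — it occurs (at step `5`) on the corner-to-corner
self-avoiding walk `φ_k` in the square `{0,…,k+13}²`, so Theorem 7.2.3 (b) (`thm723b_of_cornerWalk`) applies.
[cite: MadrasSlade1993, §9.7.2 eq. (9.7.5) (p. 350), Theorem 7.2.3 (p. 233), Proposition 7.1.3 (p. 232)] -/
theorem kestenBoundPat_holds (k : ℕ) : KestenBoundPat k := by
  have hK := phi_pathOn k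
  obtain ⟨q, hq, ε, hε, hε1, N₀, hN₀⟩ := thm723b_of_cornerWalk (d := 0) (b := k + 13) (K := 12 * k + 66)
    (φ := phi k) hK (fun t ht j => phi_mem_square k ht j)
    (fun j => by rw [phi_zero]; left; fin_cases j <;> rfl)
    (fun j => by rw [phi_last]; right; fin_cases j <;> simp)
    (by rw [phi_zero, phi_last]; intro h; have := congrFun h 0; simp at this; omega)
    (pts := patList k) (a := 5) (by rw [length_patList]; omega)
    (fun t ht => by
      rw [length_patList, show 10 * k + 40 - 1 = 10 * k + 39 by omega] at ht
      rw [getD_patList k ht, getD_patList k (by omega), pat_zero, sub_zero]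
      exact phi_occ k ht)
  refine ⟨q, hq, ε, hε, hε1, N₀, fun N hN => ?_⟩
  have h := hN₀ N hN
  have hset : ((saws (0 + 2) N).filter fun ω => patCount (d := 0) (patList k) N ω ≤ N / q) =
      (saws 2 N).filter fun ω => (occSet k N ω).card ≤ N / q := by
    refine Finset.filter_congr fun ω _ => ?_
    rw [patCount_patList]
  rw [hset] at h
  exact h

/-- ★★ **Madras–Slade Theorem 9.4.2 (`d = 2`), unconditional.** For every `k ≥ 1` there are `ε > 0` and `N₀` such
that the largest ergodicity class of MAX(`k`) on the `N`-step self-avoiding walks of `ℤ²` has at most `((1-ε) μ)^N`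
elements for all `N ≥ N₀`; hence `limsup (CLEC_{k,N})^{1/N} ≤ (1-ε) μ < μ` as printed, and every `k`-site
length-conserving algorithm (its classes refine those of MAX(`k`)) explores an exponentially small fraction of `S_N`.
[cite: MadrasSlade1993, Theorem 9.4.2 (p. 319); §9.7.2 (pp. 349–350)] -/
theorem MadrasSlade1993_thm942 {k : ℕ} (hk : 1 ≤ k) :
    ∃ ε : ℝ, 0 < ε ∧ ∃ N₀ : ℕ, ∀ N : ℕ, N₀ ≤ N → (clec k N : ℝ) ≤ ((1 - ε) * connectiveConstant 2) ^ N :=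
  MadrasSlade1993_thm942_of_kesten hk (kestenBoundPat_holds k)

end Thm942

end Literature.Probability.RandomPlanarGeometry.SAW.Zd
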